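import Summits.BirchSwinnertonDyer.Rank1Residual.Supersingular.KuriharaTwistIdentity
import Mathlib.RingTheory.AdjoinRoot
import Mathlib.RingTheory.Polynomial.Pochhammer
import Mathlib.RingTheory.Nilpotent.Basic
import Mathlib.Algebra.Polynomial.Div
import Mathlib.Data.ZMod.Units
import Mathlib.Data.Nat.Prime.Factorial
import HarnessLib

/-!
# The bins-to-`δ̃` identity as a KERNEL THEOREM: binomial moments of the sum-bins of a distribution
# system (concrete half; `B = (ℤ/q)[Y]/(Y^p)`)

Cell `b2b-bsdres`, team n1011, seat p09 GEN 3, OWNERS row T-TW3, FILE 5; sibling of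
`KuriharaTwistIdentity.lean` (FILE 4, the abstract leading-term lemma) and of the record schemas
`KuriharaTwistSchemaOdd.lean` / `KuriharaTwistSchemaLevelK.lean` (FILES 1–2), whose decidable recheck
this file JUSTIFIES IN THE KERNEL.  Namespace `Summit.BirchSwinnertonDyer.Rank1Residual.Supersingular.KuriharaTwist.Identity`.

HONEST FRAMING (run/shared/lean/b2b/bsd-rank1-residual/, verbatim in every file): the goal of the
cell is to DELETE the COMBINATION-SHAPED residual classes of the Birch–Swinnerton-Dyer formula for
ALL analytic-rank `≤ 1` elliptic curves over `ℚ` — "full BSD formula for every rank `≤ 1` curve in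
class `C`" assembled STRICTLY from published theorems — so that the rank-`≤ 1` remainder becomes
exactly the CONSTRUCTION-SHAPED classes, which are TYPED (missing-input `Prop`s), NOT attempted.
This is not "finishing BSD".  Team n1011 is a RESEARCH ROUTE; this file is a TOOL THEOREM of
elementary algebra (no named fact, no elliptic curve, nothing booked; marks unchanged).

## What this file proves

* `TruncRing q p = (ℤ/q)[Y]/(Y^p)` (`AdjoinRoot (X^p)`), `yv` = the class of `Y`, `uv = 1 + y` (a unit);
  `pow_dvd_choose_pow` (`p^k ∣ binom(p^k, i)` for `0 < i < p`) ⟹ `one_add_yv_pow`: `(1+y)^{p^k} = 1`;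
  `uv_pow_sub_one_mem` / `uv_pow_sub_one_sub_mem`: `(1+y)^v ≡ 1 (mod y)`, `≡ 1 + v·y (mod y²)`.
* `chi hp ψ` — for `ψ : H → ℤ/p^k` (a discrete logarithm) the CHARACTER `b ↦ (1+y)^{val ψ(b)}` into
  `(TruncRing (p^k) p)ˣ` (a homomorphism because `(1+y)^{p^k} = 1` — this is where `Y^p = 0` and hence
  the guard `ν < p` of the schema come from).
* `coeff_eq_zero_of_mk_mem_pow` — coefficient extraction: `f mod Y^p ∈ (y)^m`, `m ≤ p` ⟹ the first `m`
  coefficients of `f` vanish.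
* **`sum_mul_choose_eq`** / **`sum_mul_choose_val_eq`** — THE IDENTITY: for a distribution system `x`
  with eigenvalue `2` valued in `ℤ/p^k` (`p` prime), discrete logarithms `ψ_ℓ : G_ℓ → ℤ/p^k`, and a
  level `U` with `ν = |U| < p`: with `m(a) = (Σ_ℓ ψ_ℓ(a_ℓ)).val ∈ [0, p^k)` (the record's bin index),
  `Σ_a x_U(a)·binom(m(a), t) = 0` for `t < ν` and `= Σ_a x_U(a)·Π_ℓ ψ_ℓ(a_ℓ)` for `t = ν`
  — i.e. the binomial moments `e_t = Σ_j binom(j,t)·C_j` of the sum-bins `C_j = Σ_{m(a)=j} x_U(a)`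
  vanish below `ν` and `e_ν` is the Kurihara sum, at EVERY depth `k`, exactly as
  `TwistRecord.consistentOdd` / `TwistRecordK.consistent` recheck (there `x_U(a) = D·x⁺{∞, a/n} mod q` with
  `x⁺ = c_∞·[a/n]⁺`, so that `e_ν = D·c_∞·δ̃_n`; the distribution relation is the Hecke relation of
  the eigen-symbol at the good primes `ℓ ∣ n` with `a_ℓ ≡ 2 (mod q)`, read in CRT coordinates).
  (`choose_natCast_congr`: `binom(N,t) mod q` depends only on `N mod q` for `t! ⊥ q`, via `descPochhammer`.)

What is NOT here (and not needed by the schema, whose records carry the level's data): the verification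
that the plus modular symbol of a newform with `a_ℓ ≡ 2 (mod q)` at good primes `ℓ ≡ 1 (mod q)` IS such a
distribution system — that is the Hecke relation `intCast_mul_ratPlusSymbol`
(`Literature/…/PAdicLFunctionDistributionProofs.lean`) read in CRT coordinates on `(ℤ/n)ˣ ≅ Π(ℤ/ℓ)ˣ`,
left to a sibling file.  References: as FILE 4; C.-H. Kim (app. R. Pollack) arXiv:2505.09121v1 §1.1.2
(`𝒩_k`) [Kim2025RefinedTNC, PREPRINT — only for the notion of depth; nothing here depends on it].
-/

open Finset

namespace Summit.BirchSwinnertonDyer.Rank1Residual.Supersingular.KuriharaTwist.Identity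

/-! ### The concrete coefficient ring `(ℤ/q)[Y]/(Y^p)` -/

section Concrete

open Polynomial

variable (q p : ℕ)

/-- `B_{q,p} = (ℤ/q)[Y]/(Y^p)`. [folklore] -/
abbrev TruncRing : Type := AdjoinRoot ((X : (ZMod q)[X]) ^ p)

/-- `y = Y mod Y^p`. [folklore] -/
noncomputable def yv : TruncRing q p := AdjoinRoot.root _

/-- `y^p = 0`. [folklore] -/
theorem yv_pow_eq_zero : (yv q p) ^ p = 0 := by
  unfold yv
  rw [← AdjoinRoot.mk_X, ← map_pow, AdjoinRoot.mk_eq_zero]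

/-- `y` is nilpotent. [folklore] -/
theorem isNilpotent_yv : IsNilpotent (yv q p) := ⟨p, yv_pow_eq_zero q p⟩

/-- `1 + y` is a unit. [folklore] -/
theorem isUnit_one_add_yv : IsUnit (1 + yv q p) := (isNilpotent_yv q p).isUnit_one_add

/-- `u = 1 + y` as a unit. [folklore] -/
noncomputable def uv : (TruncRing q p)ˣ := (isUnit_one_add_yv q p).unit

/-- The unit `uv` is `1 + y`. [folklore] -/
@[simp] theorem coe_uv : ((uv q p : (TruncRing q p)ˣ) : TruncRing q p) = 1 + yv q p := rfl

/-- `p^k ∣ binom(p^k, i)` for `0 < i < p` (`p` prime). [folklore] -/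
theorem pow_dvd_choose_pow {p k i : ℕ} (hp : p.Prime) (hi0 : 0 < i) (hip : i < p) :
    p ^ k ∣ (p ^ k).choose i := by
  obtain ⟨j, rfl⟩ : ∃ j, i = j + 1 := ⟨i - 1, by omega⟩
  have hq : 1 ≤ p ^ k := Nat.one_le_pow _ _ hp.pos
  have key : p ^ k * (p ^ k - 1).choose j = (p ^ k).choose (j + 1) * (j + 1) := by
    have := Nat.add_one_mul_choose_eq (p ^ k - 1) j
    rwa [Nat.sub_add_cancel hq] at this
  have hcop : Nat.Coprime (p ^ k) (j + 1) := by
    refine Nat.Coprime.pow_left k ?_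
    rw [hp.coprime_iff_not_dvd]
    intro h
    exact absurd (Nat.le_of_dvd (Nat.succ_pos j) h) (by omega)
  exact hcop.dvd_of_dvd_mul_right ⟨(p ^ k - 1).choose j, by rw [← key]⟩

/-- `(1 + y)^q = 1` in `(ℤ/q)[Y]/(Y^p)` for `q = p^k`, `p` prime. [folklore] -/
theorem one_add_yv_pow {p k : ℕ} (hp : p.Prime) :
    (1 + yv (p ^ k) p) ^ (p ^ k) = 1 := by
  rw [add_comm, add_pow]
  -- split off the term i = 0; every other term vanishes
  rw [Finset.sum_eq_single 0]
  · simp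
  · intro i hi hi0
    by_cases hip : i < p
    · -- 0 < i < p: the binomial coefficient vanishes in ℤ/q
      have hdvd := pow_dvd_choose_pow (k := k) hp (Nat.pos_of_ne_zero hi0) hip
      have : ((p ^ k).choose i : TruncRing (p ^ k) p) = 0 := by
        rw [← map_natCast (algebraMap (ZMod (p ^ k)) (TruncRing (p ^ k) p)),
          (ZMod.natCast_eq_zero_iff _ _).2 hdvd, map_zero]
      rw [this, mul_zero]
    · -- i ≥ p: y^i = 0
      have : (yv (p ^ k) p) ^ i = 0 := by
        rw [← Nat.sub_add_cancel (not_lt.1 hip), pow_add, yv_pow_eq_zero, mul_zero]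
      rw [this, zero_mul, zero_mul]
  · intro h; exact absurd (Finset.mem_range.2 (Nat.pos_of_ne_zero (by positivity))) h

/-- `(1+y)^v − 1 ∈ (y)`. [folklore] -/
theorem uv_pow_sub_one_mem (v : ℕ) :
    ((uv q p ^ v : (TruncRing q p)ˣ) : TruncRing q p) - 1 ∈ Ideal.span {yv q p} := by
  rw [Ideal.mem_span_singleton, Units.val_pow_eq_pow_val, coe_uv]
  have := sub_dvd_pow_sub_pow (1 + yv q p) 1 v
  simpa using this

/-- `(1+y)^v − 1 − v·y ∈ (y)²`. [folklore] -/
theorem uv_pow_sub_one_sub_mem (v : ℕ) :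
    ((uv q p ^ v : (TruncRing q p)ˣ) : TruncRing q p) - 1 - (v : TruncRing q p) * yv q p ∈
      Ideal.span {yv q p} ^ 2 := by
  rw [Ideal.span_singleton_pow, Ideal.mem_span_singleton, Units.val_pow_eq_pow_val, coe_uv]
  induction v with
  | zero => simp
  | succ v ih =>
    obtain ⟨c, hc⟩ := ih
    refine ⟨(1 + yv q p) * c + v, ?_⟩
    have e : (1 + yv q p) ^ (v + 1) - 1 - ((v + 1 : ℕ) : TruncRing q p) * yv q p =
        (1 + yv q p) * ((1 + yv q p) ^ v - 1 - (v : TruncRing q p) * yv q p) + (v : TruncRing q p) * yv q p ^ 2 := by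
      push_cast; ring
    rw [e, hc]; ring

end Concrete



section Final

open Polynomial

variable {ι : Type*} [Fintype ι] [DecidableEq ι]
variable {G : ι → Type*} [∀ i, CommGroup (G i)] [∀ i, Fintype (G i)] [∀ i, DecidableEq (G i)]

/-- Push a distribution system along a ring homomorphism. [folklore] -/
def DistSystem.map {B B' : Type*} [CommRing B] [CommRing B'] (S : DistSystem ι G B) (f : B →+* B') :
    DistSystem ι G B' where
  x U a := f (S.x U a)
  g := S.g
  inv U a b h := by simp only [S.inv U a b h]
  dist U i hi c hc := by
    rw [← map_sum, S.dist U i hi c hc, map_sub, map_sub, map_mul, map_ofNat]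

variable {p k : ℕ}

/-- Coefficient extraction: if `f mod Y^p` lies in `(y)^m` with `m ≤ p` then the first `m` coefficients of
`f` vanish. [folklore] -/
theorem coeff_eq_zero_of_mk_mem_pow {q : ℕ} {f : (ZMod q)[X]} {m : ℕ} (hm : m ≤ p)
    (h : AdjoinRoot.mk ((X : (ZMod q)[X]) ^ p) f ∈ Ideal.span {yv q p} ^ m) :
    ∀ d < m, f.coeff d = 0 := by
  rw [Ideal.span_singleton_pow, Ideal.mem_span_singleton'] at h
  obtain ⟨c, hc⟩ := h
  obtain ⟨g, rfl⟩ := AdjoinRoot.mk_surjective c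
  have : AdjoinRoot.mk ((X : (ZMod q)[X]) ^ p) (g * X ^ m) = AdjoinRoot.mk _ f := by
    rw [← hc, map_mul, map_pow]; rfl
  rw [AdjoinRoot.mk_eq_mk] at this
  have hXm : (X : (ZMod q)[X]) ^ m ∣ f := by
    have h1 : (X : (ZMod q)[X]) ^ m ∣ g * X ^ m - f := dvd_trans (pow_dvd_pow X hm) this
    have h2 : (X : (ZMod q)[X]) ^ m ∣ g * X ^ m := dvd_mul_left _ _
    have := dvd_sub h2 h1
    simpa using this
  exact Polynomial.X_pow_dvd_iff.1 hXm

variable (hp : p.Prime)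

/-- The character `b ↦ (1+y)^{val ψ(b)}` attached to `ψ : H → ℤ/p^k`, a homomorphism because
`(1+y)^{p^k} = 1`. [folklore] -/
noncomputable def chi {H : Type*} [CommGroup H] (ψ : H →* Multiplicative (ZMod (p ^ k))) :
    H →* (TruncRing (p ^ k) p)ˣ where
  toFun b := uv (p ^ k) p ^ (Multiplicative.toAdd (ψ b)).val
  map_one' := by simp
  map_mul' a b := by
    haveI : NeZero (p ^ k) := NeZero.of_pos (pow_pos hp.pos k)
    have hq : uv (p ^ k) p ^ (p ^ k) = 1 := by
      ext; rw [Units.val_pow_eq_pow_val, coe_uv, one_add_yv_pow hp, Units.val_one]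
    rw [map_mul, toAdd_mul, ZMod.val_add, ← pow_add]
    conv_rhs => rw [← Nat.mod_add_div ((Multiplicative.toAdd (ψ a)).val + (Multiplicative.toAdd (ψ b)).val) (p ^ k),
      pow_add, pow_mul, hq, one_pow, mul_one]

/-- The value of the character `chi`: `(1+y)^{val ψ(b)}`. [folklore] -/
theorem coe_chi {H : Type*} [CommGroup H] (ψ : H →* Multiplicative (ZMod (p ^ k))) (b : H) :
    ((chi hp ψ b : (TruncRing (p ^ k) p)ˣ) : TruncRing (p ^ k) p) =
      (1 + yv (p ^ k) p) ^ (Multiplicative.toAdd (ψ b)).val := by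
  simp [chi, Units.val_pow_eq_pow_val]

include hp in
/-- **The bins-to-`δ̃` identity (unreduced exponents).**  For a distribution system with eigenvalue `2`
valued in `ℤ/p^k` and discrete logarithms `ψ_ℓ : G_ℓ → ℤ/p^k`, at a level `U` with `|U| < p`:
`Σ_a x_U(a)·binom(N(a), t) = 0` for `t < |U|` and `= Σ_a x_U(a)·Π_ℓ ψ_ℓ(a_ℓ)` for `t = |U|`, where
`N(a) = Σ_ℓ val ψ_ℓ(a_ℓ) ∈ ℕ`. [folklore] -/
theorem sum_mul_choose_eq (S : DistSystem ι G (ZMod (p ^ k)))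
    (ψ : Π i, G i →* Multiplicative (ZMod (p ^ k))) (U : Finset ι) (hU : U.card < p)
    (t : ℕ) (ht : t ≤ U.card) :
    ∑ a ∈ slice U, S.x U a * ((∑ l ∈ U, (Multiplicative.toAdd (ψ l (a l))).val).choose t : ZMod (p ^ k)) =
      if t = U.card then ∑ a ∈ slice U, S.x U a * ∏ l ∈ U, Multiplicative.toAdd (ψ l (a l)) else 0 := by
  classical
  haveI : NeZero (p ^ k) := NeZero.of_pos (pow_pos hp.pos k)
  let φ : ZMod (p ^ k) →+* TruncRing (p ^ k) p := algebraMap (ZMod (p ^ k)) (TruncRing (p ^ k) p)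
  have hφ : φ = AdjoinRoot.of _ := AdjoinRoot.algebraMap_eq _
  let S' : DistSystem ι G (TruncRing (p ^ k) p) := S.map φ
  let χ : Π i, G i →* (TruncRing (p ^ k) p)ˣ := fun i => chi hp (ψ i)
  let J : Ideal (TruncRing (p ^ k) p) := Ideal.span {yv (p ^ k) p}
  let L : Π i, G i → TruncRing (p ^ k) p := fun i b => φ (Multiplicative.toAdd (ψ i b))
  have hLcast : ∀ i (b : G i), ((Multiplicative.toAdd (ψ i b)).val : TruncRing (p ^ k) p) = L i b := by
    intro i b
    simp only [L]
    rw [← map_natCast φ, ZMod.natCast_zmod_val]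
  have hχ : ∀ i (b : G i), ((χ i b : (TruncRing (p ^ k) p)ˣ) : TruncRing (p ^ k) p) - 1 ∈ J := by
    intro i b
    exact uv_pow_sub_one_mem (p ^ k) p (Multiplicative.toAdd (ψ i b)).val
  have hL : ∀ i (b : G i),
      ((χ i b : (TruncRing (p ^ k) p)ˣ) : TruncRing (p ^ k) p) - 1 - L i b * yv (p ^ k) p ∈ J ^ 2 := by
    intro i b
    have := uv_pow_sub_one_sub_mem (p ^ k) p (Multiplicative.toAdd (ψ i b)).val
    rw [hLcast] at this
    exact this
  have hy : yv (p ^ k) p ∈ J := Ideal.mem_span_singleton_self _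
  have main := Theta_sub_mem S' χ J hχ L (yv (p ^ k) p) hy hL U
  -- Θ and the main term as images of polynomials
  let N : (Π i, G i) → ℕ := fun a => ∑ l ∈ U, (Multiplicative.toAdd (ψ l (a l))).val
  let P : (ZMod (p ^ k))[X] := ∑ a ∈ slice U, C (S.x U a) * (1 + X) ^ N a
  let c : ZMod (p ^ k) := ∑ a ∈ slice U, S.x U a * ∏ l ∈ U, Multiplicative.toAdd (ψ l (a l))
  have hTheta : Theta S' χ U = AdjoinRoot.mk ((X : (ZMod (p ^ k))[X]) ^ p) P := by
    simp only [Theta, P, map_sum, map_mul, map_pow, map_add, map_one, AdjoinRoot.mk_X, AdjoinRoot.mk_C]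
    refine Finset.sum_congr rfl fun a _ => ?_
    have h1 : S'.x U a = φ (S.x U a) := rfl
    have h2 : ∀ l, ((χ l (a l) : (TruncRing (p ^ k) p)ˣ) : TruncRing (p ^ k) p) =
        (1 + yv (p ^ k) p) ^ (Multiplicative.toAdd (ψ l (a l))).val := fun l => coe_chi hp (ψ l) (a l)
    simp only [h1, h2, Finset.prod_pow_eq_pow_sum, hφ]
    rfl
  have hMain : yv (p ^ k) p ^ U.card * ∑ a ∈ slice U, S'.x U a * ∏ l ∈ U, L l (a l) =
      AdjoinRoot.mk ((X : (ZMod (p ^ k))[X]) ^ p) (X ^ U.card * C c) := by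
    have h1 : ∀ a, S'.x U a = φ (S.x U a) := fun a => rfl
    simp only [map_mul, map_pow, AdjoinRoot.mk_X, AdjoinRoot.mk_C, c, map_sum, map_prod, h1, L, hφ]
    rfl
  rw [hTheta, hMain, ← map_sub] at main
  have hcoeff := coeff_eq_zero_of_mk_mem_pow (Nat.succ_le_of_lt hU) main t (Nat.lt_succ_of_le ht)
  rw [Polynomial.coeff_sub, sub_eq_zero] at hcoeff
  have hl : P.coeff t = ∑ a ∈ slice U, S.x U a * ((N a).choose t : ZMod (p ^ k)) := by
    simp only [P, Polynomial.finsetSum_coeff, Polynomial.coeff_C_mul, Polynomial.coeff_one_add_X_pow]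
  have hr : (X ^ U.card * C c : (ZMod (p ^ k))[X]).coeff t = if t = U.card then c else 0 := by
    rw [mul_comm, Polynomial.coeff_C_mul_X_pow]
  rw [hl, hr] at hcoeff
  exact hcoeff

end Final



section Reduced

variable {ι : Type*} [Fintype ι] [DecidableEq ι]
variable {G : ι → Type*} [∀ i, CommGroup (G i)] [∀ i, Fintype (G i)] [∀ i, DecidableEq (G i)]

/-- Binomial coefficients `binom(N, t)` modulo `q` depend only on `N mod q` when `t!` is prime to `q`
(`t!·binom(N,t) = N(N−1)⋯(N−t+1)` is a polynomial in `N`). [folklore] -/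
theorem choose_natCast_congr {q t N N' : ℕ} (hN : (N : ZMod q) = N') (ht : Nat.Coprime t.factorial q) :
    ((N.choose t : ℕ) : ZMod q) = ((N'.choose t : ℕ) : ZMod q) := by
  have key : ∀ M : ℕ, ((t.factorial : ℕ) : ZMod q) * ((M.choose t : ℕ) : ZMod q) =
      (descPochhammer (ZMod q) t).eval (M : ZMod q) := by
    intro M
    rw [descPochhammer_eval_eq_descFactorial, Nat.descFactorial_eq_factorial_mul_choose, Nat.cast_mul]
  have hu : IsUnit ((t.factorial : ℕ) : ZMod q) := (ZMod.isUnit_iff_coprime _ _).2 ht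
  have := key N
  rw [hN, ← key N'] at this
  exact hu.mul_left_cancel this

variable {p k : ℕ} (hp : p.Prime)

include hp in
/-- **The bins-to-`δ̃` identity, as the record schema uses it** (exponents REDUCED mod `q = p^k`: the bin
index of `a` is `m(a) = (Σ_ℓ ψ_ℓ(a_ℓ)).val ∈ [0, q)`).  For a distribution system with eigenvalue `2`
valued in `ℤ/p^k`, discrete logarithms `ψ_ℓ : G_ℓ → ℤ/p^k`, and a level `U` with `|U| < p`:
`Σ_a x_U(a)·binom(m(a), t) = 0` for `t < |U|`, and `= Σ_a x_U(a)·Π_ℓ ψ_ℓ(a_ℓ)` (the Kurihara sum) for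
`t = |U|`. [folklore] -/
theorem sum_mul_choose_val_eq (S : DistSystem ι G (ZMod (p ^ k)))
    (ψ : Π i, G i →* Multiplicative (ZMod (p ^ k))) (U : Finset ι) (hU : U.card < p)
    (t : ℕ) (ht : t ≤ U.card) :
    ∑ a ∈ slice U, S.x U a *
        (((∑ l ∈ U, Multiplicative.toAdd (ψ l (a l))).val.choose t : ℕ) : ZMod (p ^ k)) =
      if t = U.card then ∑ a ∈ slice U, S.x U a * ∏ l ∈ U, Multiplicative.toAdd (ψ l (a l)) else 0 := by
  haveI : NeZero (p ^ k) := NeZero.of_pos (pow_pos hp.pos k)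
  rw [← sum_mul_choose_eq hp S ψ U hU t ht]
  refine Finset.sum_congr rfl fun a _ => ?_
  congr 1
  refine choose_natCast_congr ?_ ?_
  · rw [ZMod.natCast_zmod_val, Nat.cast_sum]
    refine Finset.sum_congr rfl fun l _ => ?_
    rw [ZMod.natCast_zmod_val]
  · refine Nat.Coprime.pow_right k ?_
    rw [Nat.coprime_comm, hp.coprime_iff_not_dvd, hp.dvd_factorial, not_le]
    omega

end Reduced

end Summit.BirchSwinnertonDyer.Rank1Residual.Supersingular.KuriharaTwist.Identity
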